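/-
Copyright (c) 2026. All rights reserved.
Released under Apache 2.0 license as described in the file LICENSE.
b2b-lace LEAN TYPING SEAT 1 (lean1-g37), census row 11 (K/U/KM2 atoms at d := 10), column K_{n,0}: what-if /
input-certification lane; record certificate untouched.
-/
import Literature.Probability.FitznerVanDerHofstad2017.SrwKZeroAxisCellsD10
import Literature.Probability.FitznerVanDerHofstad2017.SrwKZeroFarRowsEnvD10
import Literature.Probability.FitznerVanDerHofstad2017.SrwRegionSplitAxisCells
import Literature.Probability.FitznerVanDerHofstad2017.SrwKSupTableD10
import HarnessLib

/-!
# `K_{n,0}` region sups at `d = 10` with the `J = 2` ENVELOPE far rows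

Input-certification module at the SRW-table parameter `d := 10` (what-if lane).  `SrwKZeroSupD10` proves literal
sups of `K_{n,0}(x) = ∫ |D̂^{(x)}(k)| Ĉ(k)ⁿ dk/(2π)^d` ((3.36) p. 1071) over the three standard regions of the
bound assembly ((5.15)–(5.16) p. 1092, §5.1 p. 1093) from the axis cells `m ≤ 5`, the `J = 0` m-uniform far
rows of `SrwKZeroFarRowsD10` (`n ≤ 3`) and the Cauchy–Schwarz cone.  This file restates ONLY the four regions
whose sup improves when the tail `|m| ≥ 6` is taken instead from the `J = 2` envelope far rows
`SrwKZeroFarRowsEnvD10.FarRowEnvD10.srwK_zero_farEnv_d10_n2 / _n3 / _n4` (at `n = 4` this is the first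
m-uniform far row at all, replacing the Cauchy–Schwarz tail from `|m| ≥ 3` on):

  `Σ_μ |x_μ| ≥ 3 → K_{2,0}(x) ≤ S³_2`,  `Σ_μ |x_μ| ≥ 2 → K_{3,0}(x) ≤ S²_3`,  `Σ_μ |x_μ| ≥ 3 → K_{3,0}(x) ≤ S³_3`,
  `Σ_μ |x_μ| ≥ 3 → K_{4,0}(x) ≤ S³_4`,

each as ONE closed term over theorems already in the tree (no new analysis, no certificate, no definition), by
the same route as `SrwKZeroSupD10`: the region lemmas `srwK_le_of_axisFamily_nodeSplits_two/three`
(`SrwRegionSplitAxisCells` §3), the axis cells `SrwKZeroAxisCellsD10.srwK_zero_cell_d10_n<n>_m<m>`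
(`m = reg, …, 5`, peeled by `axisFamily_of_cell_le_of_succ`), the envelope far row (`axisFamily_of_uniform_le`,
`M = 6`), and the cone suppliers `KSupD10.i0_valid`, `KSupD10.wOnes_valid`, `KTUD10.wTab_valid .e12`,
`KSupD10.pdTab_valid`, closed by `exists_split_of_seedBounds_cast` / `exists_pairSplit_of_seedBounds_cast` and
`decide +kernel` on the rational comparisons `i0 · w ≤ S²`.

THE NUMBERS.  `S` = the least value on the `10⁻⁶` grid above every constraint of the region (cells, envelope far
row, cone); in brackets the binding constraint; `was` = the literal of the corresponding theorem of
`SrwKZeroSupD10` (`—` where that file has none); `tree` = the CS-based region value `KTUD10.kA n 0 .e2/.e3`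
(`SrwKSupTableD10`), rounded UP at `10⁻⁶`:

* `n = 2`, `Σ|x_μ| ≥ 3`: 0.221379 [cell m=3] (was 0.221423; tree 0.269685).
* `n = 3`, `Σ|x_μ| ≥ 2`: 0.285505 [cell m=2] (was 0.286086; tree 0.349261).
* `n = 3`, `Σ|x_μ| ≥ 3`: 0.278013 [cell m=3] (was 0.286086; tree 0.338954).
* `n = 4`, `Σ|x_μ| ≥ 3`: 0.470660 [envelope far row |m|>=6] (was —; tree 0.534627).

(The other seven regions of `SrwKZeroSupD10` are bound by a cell `m ≤ 2` or by the cone node `1²` and do not move;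
they are not restated.)

Sources: Fitzner–van der Hofstad [cite: FitznerVanDerHofstad2016NoBLE, (3.36) p. 1071, (5.15)–(5.16) p. 1092,
§5.1 p. 1093]; Hara–Slade, *Mean-field critical behaviour for percolation in high dimensions*, Comm. Math. Phys. 128
(1990), Lemma 5.6 p. 367 and App. B pp. 383–385 [cite: HaraSlade1990] (sup of a lattice integral over a region by
finitely many lattice points plus a uniform tail).  Epistemic status / lane: what-if / input-certification at
`d := 10`; nothing here is a certificate of record; no dimension sentence.
-/

namespace Literature.Probability.FitznerVanDerHofstad2017

open _root_.MeasureTheory Finset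
open scoped BigOperators

namespace KZeroSupEnvD10

open KTUD10 KSupD10

/-! ### §1  Node rewriting and the cone `W`-suppliers at `j = 0` -/

/-- [folklore] -/
private theorem kz_vecOfParts_two_two : vecOfParts 10 [2, 2] = Pi.single 0 2 + Pi.single 1 2 := by decide +kernel

/-- Equal absolute profiles give equal level-set counts. [folklore] -/
private theorem kz_card_abs_eq_of_absProf_eq {z z' : Fin 10 → ℤ} (h : absProf z = absProf z') (v : ℤ) :
    Fintype.card {μ // |z μ| = v} = Fintype.card {μ // |z' μ| = v} := by
  have key : ∀ w : Fin 10 → ℤ, Fintype.card {μ // |w μ| = v} = Multiset.card ((absProf w).filter (· = v)) := by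
    intro w
    rw [Fintype.card_subtype, absProf, Multiset.filter_map, Multiset.card_map]
    rfl
  rw [key, key, h]

/-- `W_{n,j}(2e₁+e₂) = W_{n,j}(e₁+2e₂)` (same `W_d`-orbit). [cite: FitznerVanDerHofstad2016NoBLE, (5.16) p. 1092] -/
private theorem kz_srwW_vecOfParts_two_one (n j : ℕ) :
    srwW 10 n j (vecOfParts 10 [2, 1]) = srwW 10 n j (Nd.pt .e12) := by
  have hp : absProf (vecOfParts 10 [2, 1]) = absProf (Nd.pt .e12) := by decide +kernel
  obtain ⟨τ, hτ⟩ := exists_spAct_eq_of_card_abs_eq _ _ (kz_card_abs_eq_of_absProf_eq hp)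
  rw [← hτ, srwW_spAct]

/-- `W_{n,0}(2e₁+e₂) ≤ wTab n 0 .e12`. [cite: FitznerVanDerHofstad2016NoBLE, (5.16) p. 1092] -/
private theorem w21_le {n : ℕ} (hn1 : 1 ≤ n) (hn : n ≤ 4) :
    srwW 10 n 0 (vecOfParts 10 [2, 1]) ≤ ((wTab n 0 .e12 : ℚ) : ℝ) := by
  rw [kz_srwW_vecOfParts_two_one]
  exact wTab_valid .e12 hn1 hn (Nat.zero_le _)

/-- `W_{n,0}(2e₁+2e₂) ≤ pdTab n 0`. [cite: FitznerVanDerHofstad2016NoBLE, (5.16) p. 1092] -/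
private theorem w22_le {n : ℕ} (hn1 : 1 ≤ n) (hn : n ≤ 4) :
    srwW 10 n 0 (vecOfParts 10 [2, 2]) ≤ ((pdTab n 0 : ℚ) : ℝ) := by
  rw [kz_vecOfParts_two_two]
  exact pdTab_valid hn1 hn (by norm_num)

/-- `K_{n,0}` is `W_d`-invariant. [cite: FitznerVanDerHofstad2016NoBLE, (3.36) p. 1071] -/
private theorem kInv (n : ℕ) : SpInvariant (srwK 10 n 0) := fun τ x => srwK_spAct n 0 τ x

/-! ### §2  The four improved region sups -/

/-- **`K_{2,0}(x; 10) ≤ 0.221379` for `Σ|x_μ| ≥ 3`** (binding constraint: cell m=3; `SrwKZeroSupD10` value 0.221423; tree region value 0.269685). [cite: FitznerVanDerHofstad2016NoBLE, (3.36) p. 1071, (5.15)–(5.16) p. 1092, §5.1 p. 1093] -/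
theorem srwK_zero_le_of_three_le_env_d10_n2 (x : Fin 10 → ℤ) (hx : 3 ≤ ∑ j, |x j|) :
    srwK 10 2 0 x ≤ ((221379 / 1000000 : ℚ) : ℝ) := by
  have hax : ∀ m : ℤ, 3 ≤ m.natAbs → srwK 10 2 0 (Pi.single (0 : Fin 10) m) ≤ ((221379 / 1000000 : ℚ) : ℝ) :=
    axisFamily_of_cell_le_of_succ (kInv 2) 0 (m₀ := 3) (srwK_zero_cell_d10_n2_m3 0)
      (Rat.cast_le.mpr (by norm_num)) <|
    axisFamily_of_cell_le_of_succ (kInv 2) 0 (m₀ := 4) (srwK_zero_cell_d10_n2_m4 0)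
      (Rat.cast_le.mpr (by norm_num)) <|
    axisFamily_of_cell_le_of_succ (kInv 2) 0 (m₀ := 5) (srwK_zero_cell_d10_n2_m5 0)
      (Rat.cast_le.mpr (by norm_num)) <|
    axisFamily_of_uniform_le (F := srwK 10 2 0) 0 (M := 6)
      (fun m hm => FarRowEnvD10.srwK_zero_farEnv_d10_n2 0 m hm) (Rat.cast_le.mpr (by norm_num))
  have hcone : ∀ r : ℕ, 3 ≤ r → r ≤ 10 → i0 2 0 * wOnes 2 0 r ≤ (221379 / 1000000 : ℚ) ^ 2 := by
    intro r h2 h10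
    interval_cases r <;> decide +kernel
  have h := srwK_le_of_axisFamily_nodeSplits_three (d := 10) (n := 2) (by norm_num) (by norm_num) 0
    (((221379 / 1000000 : ℚ)) : ℝ) (((221379 / 1000000 : ℚ)) : ℝ) (0 : Fin 10) hax
    (exists_pairSplit_of_seedBounds_cast (d := 10) (n := 2) 0 0 (by norm_num)
      (i0_valid (by norm_num) (by norm_num)) (w21_le (by norm_num) (by norm_num)) (w22_le (by norm_num) (by norm_num))
      (by norm_num) (by decide +kernel) (by decide +kernel))
    (fun r hr2 hr => exists_split_of_seedBounds_cast (d := 10) (n := 2) 0 0 (by norm_num) (classVec 10 r 0)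
      (i0_valid (by norm_num) (by norm_num)) (wOnes_valid (by norm_num) (by norm_num) (by norm_num) ((show 2 ≤ 3 by norm_num).trans hr2) hr)
      (by norm_num) (hcone r hr2 hr)) x hx
  simpa only [max_self] using h

/-- **`K_{3,0}(x; 10) ≤ 0.285505` for `Σ|x_μ| ≥ 2`** (binding constraint: cell m=2; `SrwKZeroSupD10` value 0.286086; tree region value 0.349261). [cite: FitznerVanDerHofstad2016NoBLE, (3.36) p. 1071, (5.15)–(5.16) p. 1092, §5.1 p. 1093] -/
theorem srwK_zero_le_of_two_le_env_d10_n3 (x : Fin 10 → ℤ) (hx : 2 ≤ ∑ j, |x j|) :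
    srwK 10 3 0 x ≤ ((285505 / 1000000 : ℚ) : ℝ) := by
  have hax : ∀ m : ℤ, 2 ≤ m.natAbs → srwK 10 3 0 (Pi.single (0 : Fin 10) m) ≤ ((285505 / 1000000 : ℚ) : ℝ) :=
    axisFamily_of_cell_le_of_succ (kInv 3) 0 (m₀ := 2) (srwK_zero_cell_d10_n3_m2 0)
      (Rat.cast_le.mpr (by norm_num)) <|
    axisFamily_of_cell_le_of_succ (kInv 3) 0 (m₀ := 3) (srwK_zero_cell_d10_n3_m3 0)
      (Rat.cast_le.mpr (by norm_num)) <|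
    axisFamily_of_cell_le_of_succ (kInv 3) 0 (m₀ := 4) (srwK_zero_cell_d10_n3_m4 0)
      (Rat.cast_le.mpr (by norm_num)) <|
    axisFamily_of_cell_le_of_succ (kInv 3) 0 (m₀ := 5) (srwK_zero_cell_d10_n3_m5 0)
      (Rat.cast_le.mpr (by norm_num)) <|
    axisFamily_of_uniform_le (F := srwK 10 3 0) 0 (M := 6)
      (fun m hm => FarRowEnvD10.srwK_zero_farEnv_d10_n3 0 m hm) (Rat.cast_le.mpr (by norm_num))
  have hcone : ∀ r : ℕ, 2 ≤ r → r ≤ 10 → i0 3 0 * wOnes 3 0 r ≤ (285505 / 1000000 : ℚ) ^ 2 := by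
    intro r h2 h10
    interval_cases r <;> decide +kernel
  have h := srwK_le_of_axisFamily_nodeSplits_two (d := 10) (n := 3) (by norm_num) (by norm_num) 0
    (((285505 / 1000000 : ℚ)) : ℝ) (((285505 / 1000000 : ℚ)) : ℝ) (0 : Fin 10) hax
    (fun r hr2 hr => exists_split_of_seedBounds_cast (d := 10) (n := 3) 0 0 (by norm_num) (classVec 10 r 0)
      (i0_valid (by norm_num) (by norm_num)) (wOnes_valid (by norm_num) (by norm_num) (by norm_num) hr2 hr)
      (by norm_num) (hcone r hr2 hr)) x hx
  simpa only [max_self] using h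

/-- **`K_{3,0}(x; 10) ≤ 0.278013` for `Σ|x_μ| ≥ 3`** (binding constraint: cell m=3; `SrwKZeroSupD10` value 0.286086; tree region value 0.338954). [cite: FitznerVanDerHofstad2016NoBLE, (3.36) p. 1071, (5.15)–(5.16) p. 1092, §5.1 p. 1093] -/
theorem srwK_zero_le_of_three_le_env_d10_n3 (x : Fin 10 → ℤ) (hx : 3 ≤ ∑ j, |x j|) :
    srwK 10 3 0 x ≤ ((278013 / 1000000 : ℚ) : ℝ) := by
  have hax : ∀ m : ℤ, 3 ≤ m.natAbs → srwK 10 3 0 (Pi.single (0 : Fin 10) m) ≤ ((278013 / 1000000 : ℚ) : ℝ) :=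
    axisFamily_of_cell_le_of_succ (kInv 3) 0 (m₀ := 3) (srwK_zero_cell_d10_n3_m3 0)
      (Rat.cast_le.mpr (by norm_num)) <|
    axisFamily_of_cell_le_of_succ (kInv 3) 0 (m₀ := 4) (srwK_zero_cell_d10_n3_m4 0)
      (Rat.cast_le.mpr (by norm_num)) <|
    axisFamily_of_cell_le_of_succ (kInv 3) 0 (m₀ := 5) (srwK_zero_cell_d10_n3_m5 0)
      (Rat.cast_le.mpr (by norm_num)) <|
    axisFamily_of_uniform_le (F := srwK 10 3 0) 0 (M := 6)
      (fun m hm => FarRowEnvD10.srwK_zero_farEnv_d10_n3 0 m hm) (Rat.cast_le.mpr (by norm_num))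
  have hcone : ∀ r : ℕ, 3 ≤ r → r ≤ 10 → i0 3 0 * wOnes 3 0 r ≤ (278013 / 1000000 : ℚ) ^ 2 := by
    intro r h2 h10
    interval_cases r <;> decide +kernel
  have h := srwK_le_of_axisFamily_nodeSplits_three (d := 10) (n := 3) (by norm_num) (by norm_num) 0
    (((278013 / 1000000 : ℚ)) : ℝ) (((278013 / 1000000 : ℚ)) : ℝ) (0 : Fin 10) hax
    (exists_pairSplit_of_seedBounds_cast (d := 10) (n := 3) 0 0 (by norm_num)
      (i0_valid (by norm_num) (by norm_num)) (w21_le (by norm_num) (by norm_num)) (w22_le (by norm_num) (by norm_num))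
      (by norm_num) (by decide +kernel) (by decide +kernel))
    (fun r hr2 hr => exists_split_of_seedBounds_cast (d := 10) (n := 3) 0 0 (by norm_num) (classVec 10 r 0)
      (i0_valid (by norm_num) (by norm_num)) (wOnes_valid (by norm_num) (by norm_num) (by norm_num) ((show 2 ≤ 3 by norm_num).trans hr2) hr)
      (by norm_num) (hcone r hr2 hr)) x hx
  simpa only [max_self] using h

/-- **`K_{4,0}(x; 10) ≤ 0.470660` for `Σ|x_μ| ≥ 3`** (binding constraint: envelope far row |m|>=6; no `SrwKZeroSupD10` value; tree region value 0.534627). [cite: FitznerVanDerHofstad2016NoBLE, (3.36) p. 1071, (5.15)–(5.16) p. 1092, §5.1 p. 1093] -/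
theorem srwK_zero_le_of_three_le_env_d10_n4 (x : Fin 10 → ℤ) (hx : 3 ≤ ∑ j, |x j|) :
    srwK 10 4 0 x ≤ ((470660 / 1000000 : ℚ) : ℝ) := by
  have hax : ∀ m : ℤ, 3 ≤ m.natAbs → srwK 10 4 0 (Pi.single (0 : Fin 10) m) ≤ ((470660 / 1000000 : ℚ) : ℝ) :=
    axisFamily_of_cell_le_of_succ (kInv 4) 0 (m₀ := 3) (srwK_zero_cell_d10_n4_m3 0)
      (Rat.cast_le.mpr (by norm_num)) <|
    axisFamily_of_cell_le_of_succ (kInv 4) 0 (m₀ := 4) (srwK_zero_cell_d10_n4_m4 0)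
      (Rat.cast_le.mpr (by norm_num)) <|
    axisFamily_of_cell_le_of_succ (kInv 4) 0 (m₀ := 5) (srwK_zero_cell_d10_n4_m5 0)
      (Rat.cast_le.mpr (by norm_num)) <|
    axisFamily_of_uniform_le (F := srwK 10 4 0) 0 (M := 6)
      (fun m hm => FarRowEnvD10.srwK_zero_farEnv_d10_n4 0 m hm) (Rat.cast_le.mpr (by norm_num))
  have hcone : ∀ r : ℕ, 3 ≤ r → r ≤ 10 → i0 4 0 * wOnes 4 0 r ≤ (470660 / 1000000 : ℚ) ^ 2 := by
    intro r h2 h10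
    interval_cases r <;> decide +kernel
  have h := srwK_le_of_axisFamily_nodeSplits_three (d := 10) (n := 4) (by norm_num) (by norm_num) 0
    (((470660 / 1000000 : ℚ)) : ℝ) (((470660 / 1000000 : ℚ)) : ℝ) (0 : Fin 10) hax
    (exists_pairSplit_of_seedBounds_cast (d := 10) (n := 4) 0 0 (by norm_num)
      (i0_valid (by norm_num) (by norm_num)) (w21_le (by norm_num) (by norm_num)) (w22_le (by norm_num) (by norm_num))
      (by norm_num) (by decide +kernel) (by decide +kernel))
    (fun r hr2 hr => exists_split_of_seedBounds_cast (d := 10) (n := 4) 0 0 (by norm_num) (classVec 10 r 0)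
      (i0_valid (by norm_num) (by norm_num)) (wOnes_valid (by norm_num) (by norm_num) (by norm_num) ((show 2 ≤ 3 by norm_num).trans hr2) hr)
      (by norm_num) (hcone r hr2 hr)) x hx
  simpa only [max_self] using h

end KZeroSupEnvD10

end Literature.Probability.FitznerVanDerHofstad2017
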